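import Summits.ResolutionOfSingularities.ResolutionOfSingularities.Theorems.FrobeniusLadderFRationalResolutionIntrinsicRecipeFinite
import Summits.ResolutionOfSingularities.ResolutionOfSingularities.Theorems.FrobeniusLadderFRationalResolutionCompletionOfFlatUnramifiedAtPrime
import Literature.AlgebraicGeometry.Resolution.NormalAscentCompletion
import Literature.AlgebraicGeometry.Resolution.NormalAscent
import Literature.AlgebraicGeometry.Resolution.GeometricallyRegularFG
import Literature.AlgebraicGeometry.Deformation.T2VanishingFlatRegularFibers
import HarnessLib

/-!
# Crux `FrobeniusLadder.FRationalResolution` (stmt-ResolutionOfSingularities-15317), line `redirect`,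
# stub `stub_diagonalizableQuotientResolution` — `Ê` IS A NORMAL DOMAIN AT A NORMAL POINT
# (the slot `hdom : IsDomain Ê` of `…IntrinsicRecipeFinite.hloc_of_traceIdealCentre_then_finite_singularPoints`, p840143)

`Ê = ((B ⊗_K K')_{𝔔'})^` for `B` of finite type over the field `K`, `K'/K` finite separable. The trace-ideal algebra of the (S1)
class-group centre (p840068, p840118) needs `Ê` to be a domain; diagonalizable quotient singularities are normal, so the natural
discharge is: **`B` an integrally closed domain ⇒ `Ê` an integrally closed domain** (Zariski's analytic normality + normality ascent
along the separable base change):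

* `isRegularHom_of_isSeparable` — a finite separable field extension `K → K'` is a regular homomorphism (its fibre `K'` is smooth,
  hence geometrically regular: tree `isRegularRing_of_smooth_of_field`);
* `isRegularHom_baseChange_galois` — hence `B → B ⊗_K K'` is regular (Stacks 07C1, tree `IsRegularHom.baseChange_of_essFiniteType`);
* ★ `isDomain_and_isIntegrallyClosed_localization_baseChange` — for `B` a Noetherian integrally closed domain every local ring
  `(B ⊗_K K')_{𝔔'}` is an integrally closed domain (Stacks 0BFK, tree `IsRegularHom.isDomain_and_isIntegrallyClosed_localization`);
* ★★ `isDomain_and_isIntegrallyClosed_adicCompletion_galois` — and so is its completion `Ê` (Stacks 0C23, tree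
  `isDomain_and_isIntegrallyClosed_adicCompletion_localization_atPrime`);
* `isDomain_adicCompletion_of_chart` — alternative discharge through a residue-trivial flat unramified chart point `(C', 𝔚)` whose
  local ring is an integrally closed domain (`Ê ≅ (C'_𝔚)^`, p839250);
* ★★★ `hloc_of_traceIdealCentre_then_finite_singularPoints_of_isIntegrallyClosed` — the capstone p840143 with `hdom` replaced by
  `[IsIntegrallyClosed B]`.

Honest label: plumbing toward ONE leaf stub (no stub, crux or summit closed). No definitions, no named facts, no sorry.
[cite: StacksProject, Tag 07C1; Tag 0BFK; Tag 0C23] [cite: Matsumura1987, Thm. 23.9; Thm. 32.2]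
-/

noncomputable section

-- single-problem summit: the doubled namespace component is forced
set_option linter.dupNamespace false

open CategoryTheory AlgebraicGeometry TopologicalSpace IsLocalRing TensorProduct
open Literature.AlgebraicGeometry.Resolution
open Summit.ResolutionOfSingularities.ResolutionOfSingularities.Theorems.FRationalResolution

namespace Summit.ResolutionOfSingularities.ResolutionOfSingularities.Theorems.FRationalResolution.CompletionDomain

/-! ## §1 The separable base change is a regular homomorphism -/

/-- **A finite separable field extension is a regular homomorphism**: flat, and the fibre `κ ⊗_K K'` stays regular after every finite
extension of scalars (it is smooth over the new field). [cite: StacksProject, Tag 07C1] [cite: Matsumura1987, §32] -/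
theorem isRegularHom_of_isSeparable (K K' : Type) [Field K] [Field K'] [Algebra K K'] [FiniteDimensional K K']
    [Algebra.IsSeparable K K'] : IsRegularHom K K' := by
  haveI : Algebra.FormallyEtale K K' := Algebra.FormallyEtale.of_isSeparable K K'
  haveI : Algebra.FormallySmooth K K' := inferInstance
  haveI : Algebra.FinitePresentation K K' :=
    (Algebra.FinitePresentation.of_finiteType (R := K) (A := K')).mp inferInstance
  haveI : Algebra.Smooth K K' := ⟨inferInstance, inferInstance⟩
  refine ⟨inferInstance, fun p _ => ?_⟩
  intro L _ _ _
  haveI : Algebra.Smooth p.ResidueField (p.ResidueField ⊗[K] K') := inferInstance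
  haveI : Algebra.Smooth L (L ⊗[p.ResidueField] (p.ResidueField ⊗[K] K')) := inferInstance
  exact Literature.AlgebraicGeometry.Deformation.LichtenbaumSchlessinger.isRegularRing_of_smooth_of_field L _

/-- **`B → B ⊗_K K'` is a regular homomorphism** for `B` of finite type over `K` and `K'/K` finite separable.
[cite: StacksProject, Tag 07C1] -/
theorem isRegularHom_baseChange_galois (K K' B : Type) [Field K] [Field K'] [Algebra K K'] [FiniteDimensional K K']
    [Algebra.IsSeparable K K'] [CommRing B] [Algebra K B] [Algebra.FiniteType K B] : IsRegularHom B (B ⊗[K] K') :=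
  (isRegularHom_of_isSeparable K K').baseChange_of_essFiniteType B

/-! ## §2 Normality of the local rings of `B ⊗_K K'` and of `Ê` -/

/-- ★ **The local rings of `B ⊗_K K'` are integrally closed domains** when `B` is an integrally closed domain of finite type over `K`
and `K'/K` is finite separable. [cite: StacksProject, Tag 0BFK; Tag 033C] -/
theorem isDomain_and_isIntegrallyClosed_localization_baseChange (K : Type) [Field K] {B : Type} [CommRing B] [IsDomain B]
    [IsIntegrallyClosed B] [Algebra K B] [Algebra.FiniteType K B]
    (K' : Type) [Field K'] [Algebra K K'] [FiniteDimensional K K'] [Algebra.IsSeparable K K']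
    (𝔔' : Ideal (B ⊗[K] K')) [𝔔'.IsPrime] :
    IsDomain (Localization.AtPrime 𝔔') ∧ IsIntegrallyClosed (Localization.AtPrime 𝔔') := by
  haveI : IsNoetherianRing B := Algebra.FiniteType.isNoetherianRing K B
  haveI : Algebra.FiniteType B (B ⊗[K] K') := inferInstance
  haveI : IsNoetherianRing (B ⊗[K] K') := Algebra.FiniteType.isNoetherianRing B (B ⊗[K] K')
  exact (isRegularHom_baseChange_galois K K' B).isDomain_and_isIntegrallyClosed_localization 𝔔'

/-- ★★ **`Ê` is an integrally closed domain at a normal point**: `B` an integrally closed domain of finite type over `K`, `K'/K` finite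
separable, `𝔔'` a prime of `B ⊗_K K'`; then `((B ⊗_K K')_{𝔔'})^` is an integrally closed domain. [cite: StacksProject, Tag 0C23; Tag 0BFK] -/
theorem isDomain_and_isIntegrallyClosed_adicCompletion_galois (K : Type) [Field K] {B : Type} [CommRing B] [IsDomain B]
    [IsIntegrallyClosed B] [Algebra K B] [Algebra.FiniteType K B]
    (K' : Type) [Field K'] [Algebra K K'] [FiniteDimensional K K'] [Algebra.IsSeparable K K']
    (𝔔' : Ideal (B ⊗[K] K')) [𝔔'.IsPrime] :
    IsDomain (AdicCompletion (maximalIdeal (Localization.AtPrime 𝔔')) (Localization.AtPrime 𝔔')) ∧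
      IsIntegrallyClosed (AdicCompletion (maximalIdeal (Localization.AtPrime 𝔔')) (Localization.AtPrime 𝔔')) := by
  haveI : Algebra.FiniteType B (B ⊗[K] K') := inferInstance
  haveI : Algebra.FiniteType K (B ⊗[K] K') := Algebra.FiniteType.trans (S := B) inferInstance inferInstance
  obtain ⟨h1, h2⟩ := isDomain_and_isIntegrallyClosed_localization_baseChange K K' 𝔔'
  haveI := h1
  haveI := h2
  exact isDomain_and_isIntegrallyClosed_adicCompletion_localization_atPrime K (B := B ⊗[K] K') 𝔔'

/-- **Alternative discharge through a chart**: `C'` flat over `B'` and of finite type over a field `k`, `𝔚` maximal over `𝔔'`, unramified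
and residue-trivial, with `C'_𝔚` an integrally closed domain ⇒ `Ê = (B'_{𝔔'})^ ≅ (C'_𝔚)^` is a domain. [cite: StacksProject, Tag 0C23] -/
theorem isDomain_adicCompletion_of_chart (k : Type) [Field k] {B' C' : Type} [CommRing B'] [CommRing C'] [Algebra B' C']
    [Module.Flat B' C'] [Algebra k C'] [Algebra.FiniteType k C'] (𝔔' : Ideal B') [𝔔'.IsPrime] (𝔚 : Ideal C') [h𝔚 : 𝔚.IsMaximal]
    (h𝔚B : 𝔚.comap (algebraMap B' C') = 𝔔')
    (hunr : 𝔔'.map (algebraMap B' (Localization.AtPrime 𝔚)) = maximalIdeal (Localization.AtPrime 𝔚))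
    (hres : ∀ x : C', ∃ b' : B', x - algebraMap B' C' b' ∈ 𝔚)
    [IsDomain (Localization.AtPrime 𝔚)] [IsIntegrallyClosed (Localization.AtPrime 𝔚)] :
    IsDomain (AdicCompletion (maximalIdeal (Localization.AtPrime 𝔔')) (Localization.AtPrime 𝔔')) := by
  obtain ⟨e, -⟩ := CompletionOfFlatUnramifiedAtPrime.exists_ringEquiv_adicCompletion_localRingHom 𝔔' 𝔚 h𝔚B hunr hres
  haveI := (isDomain_and_isIntegrallyClosed_adicCompletion_localization_atPrime k (B := C') 𝔚).1
  exact e.toMulEquiv.isDomain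

/-! ## §3 The capstone at a normal point -/

/-- ★★★ **THE CLASS-GROUP CENTRE, THEN FINITELY MANY SINGULAR POINTS — AT A NORMAL POINT.**
`…IntrinsicRecipeFinite.hloc_of_traceIdealCentre_then_finite_singularPoints` (p840143) with `hdom` discharged from `B` integrally closed.
[cite: StacksProject, Tag 080B; Tag 0C23; Tag 0BFK] [cite: Matsumura1987, Thm. 20.3; §11; Thm. 8.14] -/
theorem hloc_of_traceIdealCentre_then_finite_singularPoints_of_isIntegrallyClosed (K : Type) [Field K] (X : Scheme.{0})
    [IsIntegral X] (f : X ⟶ Spec (.of K)) [LocallyOfFiniteType f]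
    {B : Type} [CommRing B] [IsDomain B] [IsIntegrallyClosed B] [Algebra K B] [Algebra.FiniteType K B]
    (ι : Spec (.of B) ⟶ X) [IsOpenImmersion ι] (hι : ι ≫ f = Spec.map (CommRingCat.ofHom (algebraMap K B)))
    (𝔭 : Ideal B) [h𝔭 : 𝔭.IsMaximal] (h𝔭0 : 𝔭 ≠ ⊥)
    (hsing : ι ⟨𝔭, h𝔭.isPrime⟩ ∉ Scheme.regularLocus X)
    (hregB : ∀ P : Spec (.of B), P.asIdeal ≠ 𝔭 → P ∈ Scheme.regularLocus (Spec (.of B)))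
    (K' : Type) [Field K'] [Algebra K K'] [FiniteDimensional K K'] [IsGalois K K']
    (𝔔' : Ideal (B ⊗[K] K')) [h𝔔' : 𝔔'.IsMaximal] (h𝔔'𝔭 : 𝔔'.comap (algebraMap B (B ⊗[K] K')) = 𝔭)
    (hfin : Set.Finite {T : Ideal (AdicCompletion (maximalIdeal (Localization.AtPrime 𝔔')) (Localization.AtPrime 𝔔')) |
      ∃ I : Ideal (AdicCompletion (maximalIdeal (Localization.AtPrime 𝔔')) (Localization.AtPrime 𝔔')),
        (I ≠ ⊥ ∧ ∀ x, (∀ a b, (∀ y ∈ I, b * y ∈ Ideal.span {a}) → b * x ∈ Ideal.span {a}) → x ∈ I) ∧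
        T = ⨆ φ : I →ₗ[AdicCompletion (maximalIdeal (Localization.AtPrime 𝔔')) (Localization.AtPrime 𝔔')]
          AdicCompletion (maximalIdeal (Localization.AtPrime 𝔔')) (Localization.AtPrime 𝔔'), LinearMap.range φ})
    (I₀ : Ideal (AdicCompletion (maximalIdeal (Localization.AtPrime 𝔔')) (Localization.AtPrime 𝔔')))
    (hI₀ : I₀ ≠ ⊥ ∧ ∀ x, (∀ a b, (∀ y ∈ I₀, b * y ∈ Ideal.span {a}) → b * x ∈ Ideal.span {a}) → x ∈ I₀)
    (hI₀np : ∀ x₀ ∈ I₀, I₀ ≠ Ideal.span {x₀})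
    (N : ℕ) (hN : N ≠ 0)
    (hfinS : (Scheme.regularLocus (affineBlowup ((∏ T ∈ hfin.toFinset, T) ^ N)))ᶜ.Finite)
    (hloc : ∀ z ∈ (Scheme.regularLocus (affineBlowup ((∏ T ∈ hfin.toFinset, T) ^ N)))ᶜ,
      Scheme.IsRegular (affineBlowup (maximalIdeal ((affineBlowup ((∏ T ∈ hfin.toFinset, T) ^ N)).presheaf.stalk z)))) :
    ∃ (V : X.Opens), ι ⟨𝔭, h𝔭.isPrime⟩ ∈ V ∧
      (∀ t : X, t ∉ Scheme.regularLocus X → t ∈ V → t = ι ⟨𝔭, h𝔭.isPrime⟩) ∧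
      ∃ (Y : Scheme.{0}) (ρ : Y ⟶ V), IsProper ρ ∧ Scheme.IsRegular Y ∧
        IsIso (ρ ∣_ (V.ι ⁻¹ᵁ ⟨Scheme.regularLocus X, isOpen_regularLocus_of_locallyOfFiniteType_field f⟩)) ∧
        Dense ((ρ ⁻¹ᵁ (V.ι ⁻¹ᵁ ⟨Scheme.regularLocus X,
          isOpen_regularLocus_of_locallyOfFiniteType_field f⟩) : Y.Opens) : Set Y) := by
  haveI : Algebra.IsSeparable K K' := IsGalois.to_isSeparable
  exact IntrinsicRecipeFinite.hloc_of_traceIdealCentre_then_finite_singularPoints K X f ι hι 𝔭 h𝔭0 hsing hregB K' 𝔔' h𝔔'𝔭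
    (isDomain_and_isIntegrallyClosed_adicCompletion_galois K K' 𝔔').1 hfin I₀ hI₀ hI₀np N hN hfinS hloc

end Summit.ResolutionOfSingularities.ResolutionOfSingularities.Theorems.FRationalResolution.CompletionDomain

end
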